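import Mathlib
import Summits.MatrixMultiplication.MatrixMultiplication.Theorems.GradedDesignFamily.Negative.CuspFormWall
import Literature.NumberTheory.GaloisRepresentations.SL2WreathResidualImage

/-!
# The cusp-form wall of the smallest subfield cell `GL₂(𝔽₄) ⊃ SL₂(𝔽₂)`: `|Y| + |Z| ≤ 6`
# (crux `LevelGradedCohnUmans.GradedDesignFamily`, stmt-MatrixMultiplication-7610; negative side,
# line `quadratic-extension-level-one-cell`, finite cell `q = 2` of stub S3 `stub_subfieldCell`)

HONEST FRAMING (B2b-5 subfield cell, generation 4).  A THEOREM ABOUT A DECIDED FINITE CELL, not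
summit progress: for every level-one separated triple `(φ(SL₂ k), Y, Z)` in `GL₂(K)` with `|k| = 2`,
`|K| = 4` (S3's clause verbatim) we prove `|Y| + |Z| ≤ 6`, hence the design volume
`|SL₂(𝔽₂)|·|Y|·|Z| = 6·|Y|·|Z| ≤ 54 < 315 = 1 + |K|³ + (|K| − 2)(|K| + 1)³` (the cell is empty at
exponent three) and `min(|Y|,|Z|) ≤ 3`.  (The exhaustive computation of the cell dossier `SUBFIELD.md`
§3 gives the exact values `|Y| + |Z| ≤ 5`, `max min(|Y|,|Z|) = 2`; this file records what the
cusp-form wall proves by theorem, completing the Lean walls for `q = 2, 3, 4, 5`.)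

PROOF.  `CuspFormWall.cuspFormWall` with the SIGN cusp form of `SL₂(𝔽₂) ≅ S₃`, written
intrinsically as `e(h) = 1` if `h³ = 1` and `−1` otherwise; cuspidality — every coset of every root
subgroup (the three subgroups of order two) contains exactly one even permutation — is the integer
identity `sl2_zmod_two_rootCoset_sum` over `ZMod 2` (`native_decide`), transported to an arbitrary
field with two elements along `ZMod.ringEquivOfPrime`.

VALUE = theorem for the finite cell `q = 2`; the asymptotic stub `stub_subfieldCell` and the crux are
untouched.
-/

set_option linter.dupNamespace false

open scoped BigOperators

namespace Summit.MatrixMultiplication.MatrixMultiplication.Theorems.GradedDesignFamily.Negative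

/-- Over `ZMod 2`: on every coset `g · (b U b⁻¹)` of every root subgroup of `SL₂(𝔽₂) ≅ S₃` the sign
form `h ↦ (1 if h³ = 1 else −1)` sums to zero (each such coset meets `A₃ = {h : h³ = 1}` exactly once).
Decided by `native_decide` (36 cosets). -/
theorem sl2_zmod_two_rootCoset_sum :
    ∀ g b : Matrix.SpecialLinearGroup (Fin 2) (ZMod 2),
      (∑ x : ZMod 2, if (g * b * ⟨!![(1 : ZMod 2), x; 0, 1], sl2md_det_upper x⟩ * b⁻¹) ^ 3 = 1
        then (1 : ℤ) else -1) = 0 := by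
  native_decide

/-- **The cusp-form wall at `q = 2`.**  For fields `k ⊂ K` with `|k| = 2`, `|K| = |k|²`, an
injective hom `φ : SL₂(k) →* GL₂(K)` and nonempty `Y, Z ⊆ GL₂(K)` level-one separated against
`φ(SL₂ k)` (S3's clause verbatim): `|Y| + |Z| ≤ (|K| + 1)(|k| − 1) + 1 = 6`.
Finite-cell theorem, not summit progress. -/
theorem subfieldCell_four_wall {k K : Type} [Field k] [Fintype k] [DecidableEq k] [Field K]
    [Fintype K] [DecidableEq K] (hk : Fintype.card k = 2)
    (φ : Matrix.SpecialLinearGroup (Fin 2) k →* Matrix.GeneralLinearGroup (Fin 2) K)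
    (hφ : Function.Injective φ) (hK : Fintype.card K = Fintype.card k ^ 2)
    (Y Z : Finset (Matrix.GeneralLinearGroup (Fin 2) K)) (hY : Y.Nonempty) (hZ : Z.Nonempty)
    (hsep : ∀ z₀ ∈ Z, ∃ cf : (Fin 2 → K) → (Fin 2 → K) → ℂ,
      ∀ a : Matrix.SpecialLinearGroup (Fin 2) k, ∀ y ∈ Y, ∀ y' ∈ Y, ∀ z ∈ Z,
        (∑ u : Fin 2 → K, cf u (((φ a * y * y'⁻¹ * z : Matrix.GeneralLinearGroup (Fin 2) K) :
            Matrix (Fin 2) (Fin 2) K).mulVec u)) =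
          if a = 1 ∧ y = y' ∧ z = z₀ then 1 else 0) :
    Y.card + Z.card ≤ 6 := by
  have h3 : Nat.Prime 2 := by norm_num
  -- transport `ZMod 2 ≃+* k` and the induced isomorphism of `SL₂`
  let ι : ZMod 2 ≃+* k := ZMod.ringEquivOfPrime k h3 hk
  let F : Matrix.SpecialLinearGroup (Fin 2) (ZMod 2) →* Matrix.SpecialLinearGroup (Fin 2) k :=
    Matrix.SpecialLinearGroup.map ι.toRingHom
  have hFcoe : ∀ a : Matrix.SpecialLinearGroup (Fin 2) (ZMod 2), ∀ i j,
      (F a : Matrix (Fin 2) (Fin 2) k) i j = ι ((a : Matrix (Fin 2) (Fin 2) (ZMod 2)) i j) := by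
    intro a i j
    rfl
  have hFinj : Function.Injective F := by
    intro a b hab
    ext i j
    have h := congrArg (fun m : Matrix.SpecialLinearGroup (Fin 2) k =>
      (m : Matrix (Fin 2) (Fin 2) k) i j) hab
    simp only [hFcoe] at h
    exact ι.injective h
  have hFsurj : Function.Surjective F := by
    intro g
    refine ⟨Matrix.SpecialLinearGroup.map ι.symm.toRingHom g, ?_⟩
    ext i j
    rw [hFcoe]
    exact ι.apply_symm_apply _
  -- the sign cusp form, intrinsically
  let e : Matrix.SpecialLinearGroup (Fin 2) k → ℂ := fun h => if h ^ 3 = 1 then 1 else -1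
  have he : ∃ a, e a ≠ 0 := ⟨1, by simp [e]⟩
  have hcusp : ∀ g b : Matrix.SpecialLinearGroup (Fin 2) k,
      ∑ x : k, e (g * b * ⟨!![(1 : k), x; 0, 1], sl2md_det_upper x⟩ * b⁻¹) = 0 := by
    intro g b
    obtain ⟨g₀, rfl⟩ := hFsurj g
    obtain ⟨b₀, rfl⟩ := hFsurj b
    have hU : ∀ x₀ : ZMod 2, (⟨!![(1 : k), ι x₀; 0, 1], sl2md_det_upper (ι x₀)⟩ :
        Matrix.SpecialLinearGroup (Fin 2) k) = F ⟨!![(1 : ZMod 2), x₀; 0, 1], sl2md_det_upper x₀⟩ := by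
      intro x₀
      ext i j
      rw [hFcoe]
      fin_cases i <;> fin_cases j <;> simp
    -- reindex the sum along `ι`
    rw [← Equiv.sum_comp ι.toEquiv]
    have hsummand : ∀ x₀ : ZMod 2,
        e (F g₀ * F b₀ * ⟨!![(1 : k), ι.toEquiv x₀; 0, 1], sl2md_det_upper (ι.toEquiv x₀)⟩ * (F b₀)⁻¹) =
          ((if (g₀ * b₀ * ⟨!![(1 : ZMod 2), x₀; 0, 1], sl2md_det_upper x₀⟩ * b₀⁻¹) ^ 3 = 1
            then (1 : ℤ) else -1 : ℤ) : ℂ) := by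
      intro x₀
      have hι : ι.toEquiv x₀ = ι x₀ := rfl
      rw [hι, hU]
      have hiff : (F (g₀ * b₀ * ⟨!![(1 : ZMod 2), x₀; 0, 1], sl2md_det_upper x₀⟩ * b₀⁻¹)) ^ 3 = 1 ↔
          (g₀ * b₀ * ⟨!![(1 : ZMod 2), x₀; 0, 1], sl2md_det_upper x₀⟩ * b₀⁻¹) ^ 3 = 1 := by
        rw [← map_pow, ← map_one F]
        exact hFinj.eq_iff
      dsimp only [e]
      by_cases hP : (g₀ * b₀ * ⟨!![(1 : ZMod 2), x₀; 0, 1], sl2md_det_upper x₀⟩ * b₀⁻¹) ^ 3 = 1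
      · have hP' : (F g₀ * F b₀ * F ⟨!![(1 : ZMod 2), x₀; 0, 1], sl2md_det_upper x₀⟩ * (F b₀)⁻¹) ^ 3 = 1 := by
          rw [← map_inv, ← map_mul, ← map_mul, ← map_mul]
          exact hiff.2 hP
        rw [if_pos hP', if_pos hP]
        push_cast
        rfl
      · have hP' : ¬ (F g₀ * F b₀ * F ⟨!![(1 : ZMod 2), x₀; 0, 1], sl2md_det_upper x₀⟩ * (F b₀)⁻¹) ^ 3 = 1 := by
          rw [← map_inv, ← map_mul, ← map_mul, ← map_mul]
          exact fun h => hP (hiff.1 h)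
        rw [if_neg hP', if_neg hP]
        push_cast
        rfl
    rw [Finset.sum_congr rfl (fun x₀ _ => hsummand x₀), ← Int.cast_sum,
      sl2_zmod_two_rootCoset_sum g₀ b₀, Int.cast_zero]
  have wall := cuspFormWall φ hφ hK Y Z hY hZ hsep e he hcusp
  rw [hK, hk] at wall
  norm_num at wall
  exact wall

/-- **Volume form of the `q = 2` cusp-form wall**: design volume
`|SL₂(k)|·|Y|·|Z| ≤ 6 · 9 = 54` (from `|Y| + |Z| ≤ 6`).  Finite-cell theorem,
not summit progress. -/
theorem subfieldCell_four_volume_le_cusp {k K : Type} [Field k] [Fintype k] [DecidableEq k]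
    [Field K] [Fintype K] [DecidableEq K] (hk : Fintype.card k = 2)
    (φ : Matrix.SpecialLinearGroup (Fin 2) k →* Matrix.GeneralLinearGroup (Fin 2) K)
    (hφ : Function.Injective φ) (hK : Fintype.card K = Fintype.card k ^ 2)
    (Y Z : Finset (Matrix.GeneralLinearGroup (Fin 2) K)) (hY : Y.Nonempty) (hZ : Z.Nonempty)
    (hsep : ∀ z₀ ∈ Z, ∃ cf : (Fin 2 → K) → (Fin 2 → K) → ℂ,
      ∀ a : Matrix.SpecialLinearGroup (Fin 2) k, ∀ y ∈ Y, ∀ y' ∈ Y, ∀ z ∈ Z,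
        (∑ u : Fin 2 → K, cf u (((φ a * y * y'⁻¹ * z : Matrix.GeneralLinearGroup (Fin 2) K) :
            Matrix (Fin 2) (Fin 2) K).mulVec u)) =
          if a = 1 ∧ y = y' ∧ z = z₀ then 1 else 0) :
    Nat.card (Matrix.SpecialLinearGroup (Fin 2) k) * Y.card * Z.card ≤ 54 := by
  have hab := subfieldCell_four_wall hk φ hφ hK Y Z hY hZ hsep
  have hcard : Nat.card (Matrix.SpecialLinearGroup (Fin 2) k) = 6 := by
    rw [Literature.NumberTheory.GaloisRepresentations.SL2Wreath.natCard_specialLinearGroup_fin_two,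
      hk]; norm_num
  rw [hcard]
  have hprod : 4 * (Y.card * Z.card) ≤ (Y.card + Z.card) * (Y.card + Z.card) := by
    nlinarith [Nat.zero_le (Y.card), Nat.zero_le (Z.card), sq_nonneg ((Y.card : ℤ) - Z.card)]
  have h6 : (Y.card + Z.card) * (Y.card + Z.card) ≤ 6 * 6 := Nat.mul_le_mul hab hab
  have : Y.card * Z.card ≤ 9 := by omega
  calc 6 * Y.card * Z.card = 6 * (Y.card * Z.card) := by ring
    _ ≤ 6 * 9 := Nat.mul_le_mul_left _ this
    _ ≤ 54 := by norm_num

/-- **`min(|Y|,|Z|) ≤ 3` in the `q = 2` subfield cell** (the exhaustive value is `2`,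
`SUBFIELD.md` §3).  Finite-cell theorem, not summit progress. -/
theorem subfieldCell_four_min_le {k K : Type} [Field k] [Fintype k] [DecidableEq k]
    [Field K] [Fintype K] [DecidableEq K] (hk : Fintype.card k = 2)
    (φ : Matrix.SpecialLinearGroup (Fin 2) k →* Matrix.GeneralLinearGroup (Fin 2) K)
    (hφ : Function.Injective φ) (hK : Fintype.card K = Fintype.card k ^ 2)
    (Y Z : Finset (Matrix.GeneralLinearGroup (Fin 2) K)) (hY : Y.Nonempty) (hZ : Z.Nonempty)
    (hsep : ∀ z₀ ∈ Z, ∃ cf : (Fin 2 → K) → (Fin 2 → K) → ℂ,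
      ∀ a : Matrix.SpecialLinearGroup (Fin 2) k, ∀ y ∈ Y, ∀ y' ∈ Y, ∀ z ∈ Z,
        (∑ u : Fin 2 → K, cf u (((φ a * y * y'⁻¹ * z : Matrix.GeneralLinearGroup (Fin 2) K) :
            Matrix (Fin 2) (Fin 2) K).mulVec u)) =
          if a = 1 ∧ y = y' ∧ z = z₀ then 1 else 0) :
    min Y.card Z.card ≤ 3 := by
  have hab := subfieldCell_four_wall hk φ hφ hK Y Z hY hZ hsep
  omega

/-- The `q = 2` subfield cell does not beat the level-one sum of cubes
`B₃(|K|) = 1 + |K|³ + (|K| − 2)(|K| + 1)³` (`= 315` at `|K| = 4`).  Finite-cell theorem, not summit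
progress. -/
theorem subfieldCell_four_le_sumCubes {k K : Type} [Field k] [Fintype k] [DecidableEq k]
    [Field K] [Fintype K] [DecidableEq K] (hk : Fintype.card k = 2)
    (φ : Matrix.SpecialLinearGroup (Fin 2) k →* Matrix.GeneralLinearGroup (Fin 2) K)
    (hφ : Function.Injective φ) (hK : Fintype.card K = Fintype.card k ^ 2)
    (Y Z : Finset (Matrix.GeneralLinearGroup (Fin 2) K)) (hY : Y.Nonempty) (hZ : Z.Nonempty)
    (hsep : ∀ z₀ ∈ Z, ∃ cf : (Fin 2 → K) → (Fin 2 → K) → ℂ,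
      ∀ a : Matrix.SpecialLinearGroup (Fin 2) k, ∀ y ∈ Y, ∀ y' ∈ Y, ∀ z ∈ Z,
        (∑ u : Fin 2 → K, cf u (((φ a * y * y'⁻¹ * z : Matrix.GeneralLinearGroup (Fin 2) K) :
            Matrix (Fin 2) (Fin 2) K).mulVec u)) =
          if a = 1 ∧ y = y' ∧ z = z₀ then 1 else 0) :
    Nat.card (Matrix.SpecialLinearGroup (Fin 2) k) * Y.card * Z.card <
      1 + Fintype.card K ^ 3 + (Fintype.card K - 2) * (Fintype.card K + 1) ^ 3 := by
  have h := subfieldCell_four_volume_le_cusp hk φ hφ hK Y Z hY hZ hsep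
  have hcard : Nat.card (Matrix.SpecialLinearGroup (Fin 2) k) = 6 := by
    rw [Literature.NumberTheory.GaloisRepresentations.SL2Wreath.natCard_specialLinearGroup_fin_two,
      hk]; norm_num
  rw [hcard] at h ⊢
  rw [hK, hk]
  norm_num
  omega

end Summit.MatrixMultiplication.MatrixMultiplication.Theorems.GradedDesignFamily.Negative
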